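import Literature.Computability.QuantumComplexity.CoreSolvable
import Literature.Computability.QuantumComplexity.PromiseWrap
import Literature.Computability.QuantumComplexity.StrandCompress
import HarnessLib

/-!
# The AJL problem is in PromiseBQP, given the classical processors and uniformity

Topic `Literature/Computability/QuantumComplexity`; the assembly step of the discharge of
`ajl_jonesApproxProblem_mem_PromiseBQP` (AJL Thm. 1.2 with §3.3: the sampled counts decide the
threshold question). We specify the classical pre-processor (`DigestSpec`: on a valid instance the
digest is well formed, its table spells the *compressed* instance word (`StrandCompress.lean`: the
strand number is binary in the instance, so free strand pairs are deleted first) on `2t` strands,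
its pattern field is `|α⟩`, and `t ≥ prec`) and the post-processor (`PostSpec`: it outputs the sampler's
decision bit computed from the test-qubit counts), prove that good samples are then decided
correctly (`prefix_true_of_yes`, `prefix_false_of_no` — using that padding a braid with unused
strands does not change the normalised Jones quantity, `ajlRatio_castWord`), and conclude
`mem_PromiseBQP_of_specs`: uniformity of the core family and `FP` processors meeting the specs put
`jonesApproxProblem` in `PromiseBQP`. (This route is independent of the older conditional reduction
`JonesInBQPProofs.ajl_jonesApproxProblem_mem_PromiseBQP_of_steps`, whose hypotheses are the generic
gate-set bridge `PromiseBQPOver_eq_PromiseBQP` and an abstract sampler; none of them is used here.)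

## References

* D. Aharonov, V. Jones, Z. Landau, Algorithmica 55 (2009), Thm. 1.2, §3.3, Claim 3.3
  [AharonovJonesLandau2009].
-/

noncomputable section

namespace Literature.Computability.QuantumComplexity

open Cryptography Complexity AJLSampler

namespace AJLCore

/-! ### Padding strands -/

/-- A braid word read on more strands (generator indices unchanged). [folklore] -/
def castWord {n n' : ℕ} (h : n ≤ n') (b : BraidWord n) : BraidWord n' :=
  b.map fun g => (Fin.castLE (by omega) g.1, g.2)

/-- Adding two unused strands at the end is `expandWord (n/2)`. [folklore] -/
theorem expandWord_eq_castWord {n : ℕ} (hn : Even n) (b : BraidWord n) :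
    expandWord (n / 2) b = castWord (by omega) b := by
  unfold expandWord castWord
  refine List.map_congr_left fun g _ => ?_
  refine Prod.ext (Fin.ext ?_) rfl
  simp only [expandGen_val, expandIdx, Fin.val_castLE]
  have := g.1.2
  obtain ⟨j, hj⟩ := hn
  rw [if_pos (by omega)]

/-- Casting composes. [folklore] -/
theorem castWord_castWord {n n' n'' : ℕ} (h : n ≤ n') (h' : n' ≤ n'') (b : BraidWord n) :
    castWord h' (castWord h b) = castWord (h.trans h') b := by
  unfold castWord; rw [List.map_map]; rfl

/-- **Unused strands do not change the normalised Jones quantity.** [cite: AharonovJonesLandau2009, Cor. 3.1 and Lemma 3.3] -/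
theorem ajlRatio_castWord {n : ℕ} (hn : Even n) (h2 : 2 ≤ n) (b : BraidWord n) :
    ∀ (j : ℕ), ajlRatio 5 (n + 2 * j) (castWord (by omega) b) = ajlRatio 5 n b
  | 0 => by unfold castWord; congr 1; exact (List.map_congr_left fun g _ => Prod.ext (Fin.ext rfl) rfl).trans (List.map_id _)
  | j + 1 => by
    have ih := ajlRatio_castWord hn h2 b j
    have hn' : Even (n + 2 * j) := hn.add (even_two_mul j)
    have hstep := ajlRatio_expandWord (l := (n + 2 * j) / 2) (by omega) hn' (by omega) (castWord (by omega) b)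
      (fun g hg => by
        unfold castWord at hg; rw [List.mem_map] at hg
        obtain ⟨g', hg', rfl⟩ := hg
        have := g'.1.2; simp only [Fin.val_castLE]; obtain ⟨i, hi⟩ := hn'; omega)
    rw [expandWord_eq_castWord hn', castWord_castWord] at hstep
    have hstep' : ajlRatio 5 (n + 2 * (j + 1)) (castWord (by omega) b) = ajlRatio 5 (n + 2 * j) (castWord (by omega) b) := hstep
    exact hstep'.trans ih

/-- The same, for any even number of strands at least `n`. [cite: AharonovJonesLandau2009, Cor. 3.1 and Lemma 3.3] -/
theorem ajlRatio_castWord_of_even {n N : ℕ} (hn : Even n) (h2 : 2 ≤ n) (hN : Even N) (hle : n ≤ N) (b : BraidWord n) :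
    ajlRatio 5 N (castWord hle b) = ajlRatio 5 n b := by
  obtain ⟨j, rfl⟩ : ∃ j, N = n + 2 * j := by
    obtain ⟨a, ha⟩ := hn; obtain ⟨c, hc⟩ := hN; exact ⟨(N - n) / 2, by omega⟩
  exact ajlRatio_castWord hn h2 b j

/-! ### The specifications of the classical processors -/

/-- The count of test qubits of type `ty` reading `1` in the output string `y` of the core family on a
digest of length `ℓ`: the bits at positions `ℓ + i` (`ty = 0`) resp. `ℓ + K + i` (`ty = 1`), `i < K`.
[cite: AharonovJonesLandau2009, §3.3] -/
def cnt (ℓ : ℕ) (y : List Bool) (ty : Bool) : ℕ :=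
  ((Finset.univ : Finset (Fin (KOf ℓ))).filter fun i : Fin (KOf ℓ) => y.getD (ℓ + ((if ty then KOf ℓ else 0) + (i : ℕ))) false = true).card

/-- The compressed form of the instance word (`StrandCompress.compressRaw` on the raw letters).
[cite: AharonovJonesLandau2009, Thm. 3.2] -/
def cword (x : RawJonesInstance) : ℕ × List (ℕ × Bool) := compressRaw x.1 (rawOf x.toBraidWord)

/-- **Specification of the digest** `h` on valid instances: writing `d = h (encode x)`, `ℓ = |d|`,
`t = tOf ℓ`: the digest is well formed, `prec ≤ t`, the compressed word fits on `2t` strands and the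
table spells it, and the pattern field is `|α⟩` on `2t` strands. (The compressed strand number is at
most `4·|word| + 3` and `prec` is unary, so `t` is polynomial in the input length.)
[cite: AharonovJonesLandau2009, §3.3 and Thm. 3.2] -/
structure DigestSpec (h : List Bool → List Bool) : Prop where
  /-- well-formedness, sizes, table and pattern -/
  spec : ∀ x : RawJonesInstance, x.IsValid →
    ∃ hW : WF (h (RawJonesInstance.encoding.encode x)).length (h (RawJonesInstance.encoding.encode x)).get,
      x.prec ≤ tOf (h (RawJonesInstance.encoding.encode x)).length ∧
      ∃ hn : (cword x).1 ≤ nOf (h (RawJonesInstance.encoding.encode x)).length,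
        WordGeom.wordOf (βOf _ (fits_of_pos hW.pos) (h (RawJonesInstance.encoding.encode x)).get) = castWord hn (toFin (cword x).1 (cword x).2) ∧
        patOf _ (fits_of_pos hW.pos) (h (RawJonesInstance.encoding.encode x)).get = encodePos (ajlAlpha (nOf (h (RawJonesInstance.encoding.encode x)).length))

/-- **Specification of the post-processor** `g`: on `⟨encode x, y⟩` it outputs the decision bit of
the sampler computed from the counts of `y`. [cite: AharonovJonesLandau2009, §3.3] -/
structure PostSpec (h g : List Bool → List Bool) : Prop where
  /-- the decision bit -/
  spec : ∀ x : RawJonesInstance, x.IsValid → ∀ y : List Bool,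
    g (boolPair (RawJonesInstance.encoding.encode x) y) =
      [accept x.2.2.1 x.2.2.2.1 x.prec (KOf (h (RawJonesInstance.encoding.encode x)).length)
        (cnt (h (RawJonesInstance.encoding.encode x)).length y false) (cnt (h (RawJonesInstance.encoding.encode x)).length y true)]

/-! ### Good samples are decided correctly -/

/-- The sampler's counts of the trial pattern read from `y` are the counts `cnt`. [folklore] -/
theorem count_eq_cnt (ℓ : ℕ) (y : List Bool) (ty : Bool) :
    count ty ((fun j : Fin (mOf ℓ) => y.getD (Eblk ℓ j (Gb ℓ).q) false) ∘ (toTrial (KOf ℓ)).symm) = cnt ℓ y ty := by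
  classical
  unfold count cnt block
  rw [Finset.filter_map, Finset.card_map]
  -- both filters read the bit `ℓ + (K·ty + i)` (`Eblk_q_val`, definitionally)
  congr 1

/-- The good event is monotone in the scale. [folklore] -/
theorem good_mono {z : ℂ} {t prec K : ℕ} (hprec : 0 < prec) (hle : prec ≤ t) {γ : Trial K → Bool} (hg : Good z t K γ) : Good z prec K γ := by
  have h : (K : ℝ) / (8 * t) ≤ K / (8 * prec) := by
    have : (0 : ℝ) < prec := by exact_mod_cast hprec
    have : (prec : ℝ) ≤ t := by exact_mod_cast hle
    gcongr
  exact ⟨hg.1.trans_le h, hg.2.trans_le h⟩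

/-- On the good event a yes-instance is accepted. [cite: AharonovJonesLandau2009, §3.3 and Claim 3.3] -/
theorem accept_of_good {z : ℂ} {θn θd prec K : ℕ} (hprec : 0 < prec) (hK : 0 < K) (hyes : (θn : ℝ) / θd + 1 / prec ≤ ‖z‖)
    {γ : Trial K → Bool} (hγ : Good z prec K γ) : accept θn θd prec K (count false γ) (count true γ) = true := by
  rw [accept_iff_le_norm]
  have hclose := norm_cEstimate_sub_lt hK hprec hγ.1 hγ.2
  have htri : ‖z‖ - ‖cEstimate K (count false γ) (count true γ)‖ ≤ ‖cEstimate K (count false γ) (count true γ) - z‖ := by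
    rw [← norm_neg (cEstimate K (count false γ) (count true γ) - z), neg_sub]; exact norm_sub_norm_le _ _
  have hp' : (0 : ℝ) < prec := by exact_mod_cast hprec
  have h12 : (1 : ℝ) / prec - 1 / (2 * prec) = 1 / (2 * prec) := by field_simp; ring
  linarith

/-- On the good event a no-instance is rejected. [cite: AharonovJonesLandau2009, §3.3 and Claim 3.3] -/
theorem not_accept_of_good {z : ℂ} {θn θd prec K : ℕ} (hprec : 0 < prec) (hK : 0 < K) (hno : ‖z‖ ≤ (θn : ℝ) / θd)
    {γ : Trial K → Bool} (hγ : Good z prec K γ) : accept θn θd prec K (count false γ) (count true γ) = false := by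
  rw [Bool.eq_false_iff, Ne, accept_iff_le_norm, not_le]
  have hclose := norm_cEstimate_sub_lt hK hprec hγ.1 hγ.2
  have htri : ‖cEstimate K (count false γ) (count true γ)‖ - ‖z‖ ≤ ‖cEstimate K (count false γ) (count true γ) - z‖ := norm_sub_norm_le _ _
  linarith

section Glue

variable {h g : List Bool → List Bool} (hh : DigestSpec h) (hg : PostSpec h g)
include hh hg

/-- **The decision bit on a good sample of a valid instance**: it is the sampler's decision on a
trial pattern that is good, at the instance's precision, for an amplitude of modulus the AJL
quantity. [cite: AharonovJonesLandau2009, Thm. 1.2 and §3.3] -/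
theorem decision_of_mem_Rcore (x : RawJonesInstance) (hx : x.IsValid) (y : List Bool) (hy : y ∈ Rcore (h (RawJonesInstance.encoding.encode x))) :
    ∃ γ : Trial (KOf (h (RawJonesInstance.encoding.encode x)).length) → Bool,
      (∃ z : ℂ, ‖z‖ = ajlRatio 5 x.1 x.toBraidWord ∧ Good z x.prec (KOf (h (RawJonesInstance.encoding.encode x)).length) γ) ∧
        0 < KOf (h (RawJonesInstance.encoding.encode x)).length ∧
        g (boolPair (RawJonesInstance.encoding.encode x) y) =
          [accept x.2.2.1 x.2.2.2.1 x.prec (KOf (h (RawJonesInstance.encoding.encode x)).length) (count false γ) (count true γ)] := by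
  obtain ⟨hW, hprec, hn, hword, hpat⟩ := hh.spec x hx
  have hgspec := hg.spec x hx y
  revert hW hprec hn hword hpat hgspec hy
  generalize h (RawJonesInstance.encoding.encode x) = d
  intro hy hW hprec hn hword hpat hgspec
  refine ⟨(fun j : Fin (mOf d.length) => y.getD (Eblk d.length j (Gb d.length).q) false) ∘ (toTrial (KOf d.length)).symm,
    ⟨z₀ d.length (fits_of_pos hW.pos) d.get, ?_, ?_⟩, ?_, ?_⟩
  · -- the modulus of the estimated amplitude is the AJL quantity (through the compressed word)
    unfold z₀; rw [hword, hpat]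
    have ht : 1 ≤ tOf d.length := hW.pos
    obtain ⟨hev, h2, -, -⟩ := compressRaw_spec hx.1 hx.2.1 (rawOf x.toBraidWord) (rawOf_lt _)
    rw [norm_ajlPosCoreMatrix_apply_encodePos (by unfold nOf; exact even_two_mul _) (by unfold nOf; omega)]
    exact (ajlRatio_castWord_of_even (n := (cword x).1) hev h2 (by unfold nOf; exact even_two_mul _) hn _).trans (ajlRatio_compressRaw x hx)
  · exact good_mono hx.2.2.2.2 hprec (hy hW)
  · have := hW.pos; unfold KOf; positivity
  · rw [hgspec, ← count_eq_cnt, ← count_eq_cnt]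

/-- **Yes-instances: good samples are accepted.** [cite: AharonovJonesLandau2009, Thm. 1.2 and §3.3] -/
theorem prefix_true_of_yes : ∀ x ∈ jonesApproxProblem.yes, ∀ y ∈ Rcore (h x), [true] <+: g (boolPair x y) := by
  rintro _ ⟨x, ⟨hvalid, hineq⟩, rfl⟩ y hy
  obtain ⟨γ, ⟨z, hz, hgood⟩, hK, hgy⟩ := decision_of_mem_Rcore hh hg x hvalid y hy
  rw [hgy, accept_of_good (prec := x.prec) hvalid.2.2.2.2 hK (by rw [hz]; exact hineq) hgood]

/-- **No-instances: good samples are rejected.** [cite: AharonovJonesLandau2009, Thm. 1.2 and §3.3] -/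
theorem prefix_false_of_no : ∀ x ∈ jonesApproxProblem.no, ∀ y ∈ Rcore (h x), [false] <+: g (boolPair x y) := by
  rintro _ ⟨x, ⟨hvalid, hineq⟩, rfl⟩ y hy
  obtain ⟨γ, ⟨z, hz, hgood⟩, hK, hgy⟩ := decision_of_mem_Rcore hh hg x hvalid y hy
  rw [hgy, not_accept_of_good (prec := x.prec) hvalid.2.2.2.2 hK (by rw [hz]; exact hineq) hgood]

end Glue

/-! ### Assembly -/

/-- **The AJL problem is in `PromiseBQP`**, given uniformity of the core family and classical
processors in `FP` meeting the specifications. [cite: AharonovJonesLandau2009, Thm. 1.2] -/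
theorem mem_PromiseBQP_of_specs (hU : family.IsUniform) {h g : List Bool → List Bool} (hhFP : h ∈ FP) (hgFP : g ∈ FP)
    (hh : DigestSpec h) (hg : PostSpec h g) : ajl_jonesApproxProblem_mem_PromiseBQP :=
  mem_PromiseBQP_of_isQSolvable jonesApproxProblem h g hhFP hgFP ⟨family, family_isOracleFree, hU, twoThirds_le_kernelProb⟩
    (prefix_true_of_yes hh hg) (prefix_false_of_no hh hg)

end AJLCore

end Literature.Computability.QuantumComplexity

end
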